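import Mathlib.Probability.BrownianMotion.Basic
import Mathlib.Probability.Independence.Process.HasIndepIncrements.Basic
import Literature.Probability.Process.KolmogorovExtension
import Literature.Probability.Process.BrownianMotion
import HarnessLib

-- provenance: harness21/H21/H21/Statements/CritPerc/BrownianMotion.lean @ ecd7fd8 (interim HEAD d8f2665); M5 mechanical rewrite
/-!
# Existence of Brownian motion (family `crit-perc`, statement S27)

Target statement **crit-perc.S27** of the gap inventory:

> Existence of Brownian motion (Wiener): there is a probability space carrying a process
> `B : ℝ≥0 → Ω → ℝ` with `B₀ = 0`, independent stationary Gaussian increments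
> `B_t − B_s ∼ N(0, t − s)` and a.s. continuous paths (equivalently: Wiener measure on
> `C([0,∞))` exists).

We state it in four forms, all on top of Mathlib's predicates
`ProbabilityTheory.IsPreBrownianReal`, `ProbabilityTheory.IsBrownianReal`,
`ProbabilityTheory.HasIndepIncrements`, `ProbabilityTheory.HasLaw`,
`ProbabilityTheory.gaussianReal`, `MeasureTheory.IsProjectiveLimit` and
`ProbabilityTheory.BrownianReal.projectiveFamily` (all used, not redefined), and of the H21
prelude (`Literature.Probability.Process.preWienerMeasure`, `Literature.Probability.Process.brownian`, `Literature.Probability.Process.projectiveLimit`):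

* `Literature.Probability.RandomPlanarGeometry.exists_brownianMotion`: the inventory's wording, on the canonical space
  `(ℝ≥0 → ℝ, preWienerMeasure)`, witnessed by `Literature.Probability.Process.brownian` (proved from the prelude API);
* `Literature.Probability.RandomPlanarGeometry.exists_isBrownianReal_canonical`: `∃ B, IsBrownianReal B preWienerMeasure`;
* `ProbabilityTheory.IsPreBrownianReal.exists_isBrownianReal'`: the abstract-`Ω` corollary of
  Kolmogorov–Chentsov (every pre-Brownian motion has a Brownian modification);
* `Literature.Probability.RandomPlanarGeometry.existsUnique_isProjectiveLimit_brownian`: the Kolmogorov extension of the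
  Brownian finite-dimensional family exists and is unique ("Wiener measure exists", in its
  product-σ-algebra form).

## Design choices

* In `exists_brownianMotion` the increment variance is written `t - s : ℝ≥0` under the
  hypothesis `s ≤ t`, so truncated subtraction on `ℝ≥0` is harmless (it agrees with
  `nndist s t`, cf. Mathlib `IsPreBrownianReal.hasLaw_sub`).
* `IsPreBrownianReal.exists_isBrownianReal'` is a deliberate dot-notation extension declared in
  Mathlib's namespace `ProbabilityTheory.IsPreBrownianReal` (primed to avoid any clash with a
  future Mathlib lemma); everything else lives in `namespace Literature.CritPerc`.

## References

* N. Wiener, *Differential space*, J. Math. and Phys. 2 (1923), 131–174.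
* P. Lévy, *Processus stochastiques et mouvement brownien*, Gauthier-Villars (1948).
* O. Kallenberg, *Foundations of Modern Probability* (2nd ed., 2002), Thm 13.5 (existence of
  Brownian motion), Thm 6.16 (Kolmogorov extension).
* R. Degenne, E. Marion et al., *Formalization of Brownian motion in Lean*, arXiv:2511.20118.
-/

open MeasureTheory ProbabilityTheory ProbabilityTheory.BrownianReal
open scoped ENNReal NNReal Topology

namespace ProbabilityTheory

/-- **crit-perc.S27** (existence of Brownian motion, abstract-`Ω` form). Dot-notation
extension declared in Mathlib's namespace `ProbabilityTheory.IsPreBrownianReal`.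
Every pre-Brownian motion `X` on a probability space `(Ω, P)` admits a modification `B` which
is a Brownian motion (a.s. continuous paths); corollary of the Kolmogorov–Chentsov theorem
(`IsPreBrownianReal.exists_modification_isBrownianReal`, prelude C2, now a named fact and
therefore the hypothesis `hmod`).
Wiener (1923); Lévy (1948); Kallenberg, *Foundations of Modern Probability* (2002),
Thm 13.5. [cite: Wiener1923] -/
theorem IsPreBrownianReal.exists_isBrownianReal' {Ω : Type*} [MeasurableSpace Ω]
    {P : Measure Ω} [IsProbabilityMeasure P] {X : ℝ≥0 → Ω → ℝ}
    (hmod : IsPreBrownianReal.exists_modification_isBrownianReal (X := X) (P := P))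
    (h : IsPreBrownianReal X P) :
    ∃ B : ℝ≥0 → Ω → ℝ, IsBrownianReal B P ∧ ∀ t, X t =ᵐ[P] B t := by
  obtain ⟨B, hXB, hB, -, -, -⟩ := hmod h
  exact ⟨B, hB, hXB⟩

end ProbabilityTheory

namespace Literature.Probability.RandomPlanarGeometry

section CritPerc

/-- **crit-perc.S27** (existence of Brownian motion, inventory wording). On the canonical
probability space `(ℝ≥0 → ℝ, preWienerMeasure)` there is a process `B` with `B 0 = 0`,
independent increments, stationary Gaussian increments `B t - B s ∼ 𝓝(0, t - s)` for `s ≤ t`,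
and almost surely continuous paths. Witness: the canonical Brownian motion `Literature.Probability.Process.brownian`
(prelude C2), given its standing existence fact `Literature.Probability.Process.exists_isBrownianReal_measurable_continuous`
(hypothesis `h`). Wiener, *Differential space* (1923); Lévy (1948); Kallenberg, *Foundations of
Modern Probability* (2002), Thm 13.5. [cite: Levy1948] -/
theorem exists_brownianMotion (h : Process.exists_isBrownianReal_measurable_continuous) :
    ∃ B : ℝ≥0 → (ℝ≥0 → ℝ) → ℝ, (∀ ω, B 0 ω = 0) ∧ HasIndepIncrements B Process.preWienerMeasure ∧
      (∀ s t : ℝ≥0, s ≤ t → HasLaw (B t - B s) (gaussianReal 0 (t - s)) Process.preWienerMeasure) ∧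
      ∀ᵐ ω ∂Process.preWienerMeasure, Continuous (B · ω) := by
  refine ⟨Process.brownian, fun ω ↦ ?_, Process.hasIndepIncrements_brownian h, fun s t hst ↦ ?_,
    ae_of_all _ Process.continuous_brownian⟩
  · exact congrFun Process.brownian_zero ω
  · have h := Process.hasLaw_brownian_sub h t s
    have hd : nndist t.1 s.1 = t - s := by
      apply NNReal.eq
      rw [NNReal.coe_sub hst, coe_nndist, Real.dist_eq]
      exact abs_of_nonneg (sub_nonneg.mpr (NNReal.coe_le_coe.mpr hst))
    rwa [hd] at h

/-- **crit-perc.S27** (existence of Brownian motion, predicate form). There is a Brownian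
motion in the sense of Mathlib's `ProbabilityTheory.IsBrownianReal` on the canonical space
`(ℝ≥0 → ℝ, preWienerMeasure)`; witness `Literature.Probability.Process.brownian` (`Literature.Probability.Process.isBrownianReal_brownian`, given
the standing existence fact `Literature.Probability.Process.exists_isBrownianReal_measurable_continuous`, hypothesis `h`).
Wiener (1923); Lévy (1948); Kallenberg, *Foundations of Modern Probability* (2002),
Thm 13.5. [cite: Wiener1923] -/
theorem exists_isBrownianReal_canonical (h : Process.exists_isBrownianReal_measurable_continuous) :
    ∃ B : ℝ≥0 → (ℝ≥0 → ℝ) → ℝ, IsBrownianReal B Process.preWienerMeasure :=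
  ⟨Process.brownian, Process.isBrownianReal_brownian h⟩

/-- **crit-perc.S27** (existence of Wiener measure, Kolmogorov-extension form). The Gaussian
projective family `ProbabilityTheory.BrownianReal.projectiveFamily` of finite-dimensional
laws of Brownian motion has a unique projective limit on `ℝ≥0 → ℝ` (product σ-algebra), namely
`Literature.Probability.Process.preWienerMeasure`; "equivalently: Wiener measure exists". Kolmogorov extension theorem
(`Literature.Probability.Process.existsUnique_isProjectiveLimit`, prelude C1, now a named fact and therefore the hypothesis
`hK`) applied to Mathlib's `BrownianReal.isProjectiveMeasureFamily_projectiveFamily`.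
Wiener (1923); Kallenberg, *Foundations of Modern Probability* (2002), Thm 6.16 and
Thm 13.5. [cite: Wiener1923] -/
theorem existsUnique_isProjectiveLimit_brownian
    (hK : Process.existsUnique_isProjectiveLimit (ι := ℝ≥0) (α := fun _ ↦ ℝ)) :
    ∃! μ : Measure (ℝ≥0 → ℝ), IsProjectiveLimit (α := fun _ ↦ ℝ) μ projectiveFamily :=
  hK isProjectiveMeasureFamily_projectiveFamily

end CritPerc

end Literature.Probability.RandomPlanarGeometry
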